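import Summits.ResolutionOfSingularities.ResolutionOfSingularities.Theorems.FrobeniusLadderFInjectiveMacaulayficationTowerPersistenceKit
import Summits.ResolutionOfSingularities.ResolutionOfSingularities.Theorems.FrobeniusLadderFInjectiveMacaulayficationIntrinsicTowerRecipes
import Summits.ResolutionOfSingularities.ResolutionOfSingularities.Theorems.FrobeniusLadderFInjectiveMacaulayficationFTemkinClosedPoints
import Literature.AlgebraicGeometry.Resolution.BlowupsFlatBaseChange
import Mathlib.AlgebraicGeometry.PullbackCarrier
import HarnessLib

/-!
# NEG-T (T3): LOCAL→GLOBAL TRANSFER OF RECIPE TOWERS along flat preimmersions (pro-open subschemes `T ×_X Spec 𝒪_{X,v}`)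
# (crux `FInjectiveMacaulayfication` stmt-ResolutionOfSingularities-15315, chain w45a; res-L1-w45a-plan-1 RULING R19.23 «NEG-T», brick (T3) with (T1) as a named hypothesis;
# seat res-L1-w45a-lead-1 g9; diagnosis res-L1-w45a-tri-2 «GAP (LOC)» bus l.81780)

[OURS · L1 W4.5a] Support file (`--supports stmt-ResolutionOfSingularities-15315 --as helper`); def-free, fact-free, UNCONDITIONAL (the recipe-locality (T1) is a HYPOTHESIS `hcomap` of the
generic theorem, to be discharged per recipe). Nothing of the crux is proved. AI-written (weaker than expert review).

WHY. The tower conjectures (`Recipes.TowerTerminates c`) speak about the LOCAL floor `S′ = B ×_X Spec 𝒪_{X,v}`; the loop certificates (NEG-1…5, (L-g)) live on GLOBAL floors. The bridge: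
if every `c`-tower of height `n` from the local floor ends `Q`-good everywhere, so does every `c`-tower of height `n` from the global floor — PROVIDED the global floor is `Q`-good off a closed
set `Z` inside the pro-open range (e.g. regular off the fibre of the isolated singular point `v`) and the recipe commutes with the pro-open base change (T1).
* §1 ★★ `tower_of_flat_preimmersion` — generic over the point property `Q` (invariant under isomorphic stalk maps), the tower predicate `T` (unfolding iffs), the centre map `c` with
  `supp (c S) ⊆ closure {¬Q}` and the locality hypothesis `hcomap`; induction over FLAT PREIMMERSIONS `f : S′ ⟶ S` (stable under base change — no pasting isomorphisms needed):
  blow-ups commute with flat base change (Literature `IsBlowup.pullback_snd_of_flat`, (T2)), a blow-up is a stalk-isomorphism off its centre (p631132 `isIso_stalkMap_of_isBlowup_of_not_mem`, (T4)),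
  `range (pullback.fst g f) = g⁻¹(range f)` (Mathlib).
* §2 ★ `recipeTowerFull_of_flat_preimmersion` (the `RecipeTowerFull c p` / `FullCl` instance, any recipe `c` with `supp ⊆ closure(non-FULL)`), ★ `recipeTowerFull_nonFullCentre_of_pullback_fromSpecStalk`
  — THE NEG-T SHAPE for `N_red`: for `h : T ⟶ X`, `v` a closed point, `T` FULL off `h⁻¹ v`, and (T1) for `nonFullCentre`:
  `RecipeTowerFull nonFullCentre p n (pullback h (X.fromSpecStalk v)) → RecipeTowerFull nonFullCentre p n T`.
[cite: GortzWedhorn2020, Prop. 13.91 (2)] [cite: Temkin2008, §2.1] [cite: StacksProject, Tag 01J7]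
-/

-- single-problem summit: the doubled namespace component is forced
set_option linter.dupNamespace false

noncomputable section

open AlgebraicGeometry CategoryTheory CategoryTheory.Limits Literature.AlgebraicGeometry.Resolution TopologicalSpace IsLocalRing

namespace Summit.ResolutionOfSingularities.ResolutionOfSingularities.Theorems.FInjectiveMacaulayfication.RecipeTowerTransfer

open Summit.ResolutionOfSingularities.ResolutionOfSingularities.Theorems.FInjectiveMacaulayfication
open SliceableCentre IntrinsicTower IntrinsicTower.Recipes FullCentreDescent

/-! ## §1 The generic transfer along flat preimmersions -/

/-- ★★ **TOWER TRANSFER ALONG A FLAT PREIMMERSION** (generic). `Q` a point property invariant under isomorphic stalk maps; `T n S` the tower predicate «every chain of `n` blowing ups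
along the `c`-centres from `S` ends `Q`-good everywhere» (given by its two unfolding iffs); the centre `c S` supported inside the closure of the `Q`-bad locus; (T1) `hcomap`: along a flat
preimmersion whose range contains the closure of the `Q`-bad locus, the centre pulls back to the centre. THEN for a flat preimmersion `f : S′ ⟶ S` and a closed `Z ⊆ range f` off which `S` is
`Q`-good: `T n S′ → T n S`. [OURS · folklore assembly; GW 13.91 (2)] -/
theorem tower_of_flat_preimmersion (Q : (S : Scheme.{0}) → S → Prop)
    (hQ : ∀ {X Y : Scheme.{0}} (π : X ⟶ Y) (x : X) [IsIso (π.stalkMap x)], Q Y (π.base x) ↔ Q X x)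
    (T : ℕ → Scheme.{0} → Prop) (c : (S : Scheme.{0}) → S.IdealSheafData)
    (h0 : ∀ (S : Scheme.{0}), T 0 S ↔ ∀ s : S, Q S s)
    (hsucc : ∀ (n : ℕ) (S : Scheme.{0}), T (n + 1) S ↔ ∀ (S₁ : Scheme.{0}) (g : S₁ ⟶ S), IsBlowup g (c S) → T n S₁)
    (hsupp : ∀ (S : Scheme.{0}), ((c S).support : Set S) ⊆ closure {s : S | ¬ Q S s})
    (hcomap : ∀ {S S' : Scheme.{0}} (f : S' ⟶ S) [Flat f] [IsPreimmersion f], closure {s : S | ¬ Q S s} ⊆ Set.range f.base → (c S).comap f = c S') :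
    ∀ (n : ℕ) (S S' : Scheme.{0}) (f : S' ⟶ S) [Flat f] [IsPreimmersion f] (Z : Set S),
      IsClosed Z → Z ⊆ Set.range f.base → (∀ s : S, s ∉ Z → Q S s) → T n S' → T n S := by
  intro n
  induction n with
  | zero =>
    intro S S' f _ _ Z _ hZ hgood hT
    rw [h0] at hT ⊢
    intro s
    by_cases hs : s ∈ Z
    · obtain ⟨s', rfl⟩ := hZ hs
      haveI := isIso_stalkMap_of_flat_of_isPreimmersion f s'
      exact (hQ f s').mpr (hT s')
    · exact hgood s hs
  | succ n ih =>
    intro S S' f _ _ Z hZc hZ hgood hT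
    rw [hsucc] at hT ⊢
    intro S₁ g hg
    -- the bad locus of `S` lies in `Z`, hence its closure does, hence inside the range of `f`
    have hbadZ : closure {s : S | ¬ Q S s} ⊆ Z := hZc.closure_subset_iff.mpr fun s hs => by_contra fun hsZ => hs (hgood s hsZ)
    -- base change of the blow-up `g` along `f`: a blow-up of `S'` along the pulled-back centre = the centre of `S'` (T1)
    have hg' : IsBlowup (pullback.snd g f) (c S') := by
      rw [← hcomap f (hbadZ.trans hZ)]
      exact hg.pullback_snd_of_flat f
    have hT₁ : T n (pullback g f) := hT _ _ hg'
    -- induction hypothesis for the flat preimmersion `pullback.fst g f : S₁ ×_S S' ⟶ S₁` and the closed set `g ⁻¹ Z`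
    refine ih S₁ (pullback g f) (pullback.fst g f) (g.base ⁻¹' Z) (hZc.preimage g.base.hom.continuous) ?_ ?_ hT₁
    · intro s₁ hs₁
      rw [Scheme.Pullback.range_fst]
      exact hZ hs₁
    · intro s₁ hs₁
      -- off `Z` the blow-up `g` does not change the local ring, and `S` is `Q`-good there
      have hns : g.base s₁ ∉ ((c S).support : Set S) := fun h => hs₁ (hbadZ (hsupp S h))
      haveI := isIso_stalkMap_of_isBlowup_of_not_mem hg s₁ hns
      exact (hQ g s₁).mp (hgood _ hs₁)

/-! ## §2 The `RecipeTowerFull` instances -/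

/-- `FullCl p` of the stalk is invariant under isomorphic stalk maps (both directions; p-FTemkinClosedPoints). [folklore] -/
theorem fullCl_stalk_iff_of_isIso_stalkMap (p : ℕ) {X Y : Scheme.{0}} (π : X ⟶ Y) (x : X) [IsIso (π.stalkMap x)] :
    FullCl p (Y.presheaf.stalk (π.base x)) ↔ FullCl p (X.presheaf.stalk x) :=
  ⟨FTemkinClosedPoints.fullCl_of_isIso_stalkMap' p π x, FTemkinClosedPoints.fullCl_of_isIso_stalkMap p π x⟩

/-- ★ **TRANSFER FOR `RecipeTowerFull c p`** (any recipe whose centre is supported inside the closure of the non-FULL locus, with its (T1) locality as hypothesis): along a flat preimmersion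
`f : S′ ⟶ S` with `S` FULL off a closed `Z ⊆ range f`, `RecipeTowerFull c p n S′ → RecipeTowerFull c p n S`. [OURS] -/
theorem recipeTowerFull_of_flat_preimmersion (c : CentreRecipe) (p : ℕ)
    (hsupp : ∀ (S : Scheme.{0}), ((c p S).support : Set S) ⊆ closure (nonFullLocus p S))
    (hcomap : ∀ {S S' : Scheme.{0}} (f : S' ⟶ S) [Flat f] [IsPreimmersion f], closure (nonFullLocus p S) ⊆ Set.range f.base → (c p S).comap f = c p S')
    (n : ℕ) {S S' : Scheme.{0}} (f : S' ⟶ S) [Flat f] [IsPreimmersion f] (Z : Set S) (hZc : IsClosed Z) (hZ : Z ⊆ Set.range f.base)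
    (hfull : ∀ s : S, s ∉ Z → FullCl p (S.presheaf.stalk s)) (hT : RecipeTowerFull c p n S') : RecipeTowerFull c p n S :=
  tower_of_flat_preimmersion (fun S s => FullCl p (S.presheaf.stalk s)) (fun π x _ => fullCl_stalk_iff_of_isIso_stalkMap p π x)
    (RecipeTowerFull c p) (c p) (fun _ => Iff.rfl) (fun _ _ => Iff.rfl) hsupp (fun f _ _ h => hcomap f h) n S S' f Z hZc hZ hfull hT

/-- The `N_red` centre is supported inside the closure of the non-FULL locus (by construction). [OURS] -/
theorem support_nonFullCentre_subset (p : ℕ) (S : Scheme.{0}) :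
    ((nonFullCentre p S).support : Set S) ⊆ closure (nonFullLocus p S) := by
  simp only [nonFullCentre, Scheme.IdealSheafData.coe_support_vanishingIdeal]
  exact closure_mono Set.inter_subset_left

/-- ★ **NEG-T FOR `N_red`, pro-open form.** `h : T ⟶ X`, `v ∈ X` a closed point, `T` FULL at every point not over `v`, and the (T1) locality of `nonFullCentre p` along flat preimmersions
(hypothesis `hcomap`): every bound on the `N_red`-towers of the LOCAL floor `T ×_X Spec 𝒪_{X,v}` is a bound on the `N_red`-towers of `T`:
`RecipeTowerFull nonFullCentre p n (pullback h (X.fromSpecStalk v)) → RecipeTowerFull nonFullCentre p n T`. [OURS · GW 13.91 (2), Temkin 2008 §2.1] -/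
theorem recipeTowerFull_nonFullCentre_of_pullback_fromSpecStalk (p : ℕ)
    (hcomap : ∀ {S S' : Scheme.{0}} (f : S' ⟶ S) [Flat f] [IsPreimmersion f],
      closure (nonFullLocus p S) ⊆ Set.range f.base → (nonFullCentre p S).comap f = nonFullCentre p S')
    {X T : Scheme.{0}} (h : T ⟶ X) (v : X) (hv : IsClosed ({v} : Set X))
    (hfull : ∀ s : T, h.base s ≠ v → FullCl p (T.presheaf.stalk s)) (n : ℕ)
    (hT : RecipeTowerFull nonFullCentre p n (pullback h (X.fromSpecStalk v))) : RecipeTowerFull nonFullCentre p n T := by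
  haveI : Flat (X.fromSpecStalk v) := flat_fromSpecStalk X v
  refine recipeTowerFull_of_flat_preimmersion nonFullCentre p (support_nonFullCentre_subset p) hcomap n (pullback.fst h (X.fromSpecStalk v))
    (h.base ⁻¹' {v}) (hv.preimage h.base.hom.continuous) ?_ (fun s hs => hfull s hs) hT
  intro s hs
  exact mem_range_pullback_fst_fromSpecStalk_of_eq (π := h) (x := v) hs

/-- The same with an EXISTENTIAL height (the conjectures' conclusion shape `∃ n, RecipeTowerFull c p n _`). [OURS] -/
theorem exists_recipeTowerFull_nonFullCentre_of_pullback_fromSpecStalk (p : ℕ)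
    (hcomap : ∀ {S S' : Scheme.{0}} (f : S' ⟶ S) [Flat f] [IsPreimmersion f],
      closure (nonFullLocus p S) ⊆ Set.range f.base → (nonFullCentre p S).comap f = nonFullCentre p S')
    {X T : Scheme.{0}} (h : T ⟶ X) (v : X) (hv : IsClosed ({v} : Set X))
    (hfull : ∀ s : T, h.base s ≠ v → FullCl p (T.presheaf.stalk s))
    (hT : ∃ n : ℕ, RecipeTowerFull nonFullCentre p n (pullback h (X.fromSpecStalk v))) : ∃ n : ℕ, RecipeTowerFull nonFullCentre p n T := by
  obtain ⟨n, hn⟩ := hT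
  exact ⟨n, recipeTowerFull_nonFullCentre_of_pullback_fromSpecStalk p hcomap h v hv hfull n hn⟩

end Summit.ResolutionOfSingularities.ResolutionOfSingularities.Theorems.FInjectiveMacaulayfication.RecipeTowerTransfer

end
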